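import Literature.NumberTheory.Sieve.LinearEquationsInPrimesThreeForms
import Literature.NumberTheory.Sieve.LinearEquationsInPrimesTwinSystem
import Literature.NumberTheory.Sieve.ParityWave0TernaryGoldbachProofs
import Literature.NumberTheory.Sieve.SingularSeriesProofs
import HarnessLib

/-!
# Vinogradov's three-primes theorem — PROVED, as the `t = 3` instance of the tree's unconditional
Green–Tao theorem (`GreenTao2010_mainTheorem_of_le_three`)

**Theorem (I. M. Vinogradov 1937).** Every sufficiently large odd integer `N` is a sum of three
primes; more precisely the weighted count `R(N) = ∑_{n₁+n₂+n₃=N} Λ(n₁)Λ(n₂)Λ(n₃)` satisfies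
`R(N) = 𝔖(N) N²/2 + o(N²)` with the ternary Goldbach singular series `𝔖(N)`, and `𝔖(N) ≥ 1` for
odd `N` [Nathanson, GTM 164, Theorem 8.7 (with the stronger error `O_A(N²(log N)^{-A})`, NOT
claimed here) and Theorem 8.1; Vaughan, *The Hardy–Littlewood Method*, Theorem 3.4]. The error
`o(N²)` is exactly what the Green–Tao theorem gives for the complexity-1 system
`Ψ_N(n₁, n₂) = (n₁, n₂, N − n₁ − n₂)` on the triangle `K_N = {x₁, x₂ ≥ 0, x₁ + x₂ ≤ N}`
[Green–Tao, Ann. of Math. 171 (2010), "Examples 1" (the system `(n₁, n₂, N − n₁ − n₂)` has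
complexity 1) and Cor. 1.7 (Vinogradov's theorem as a corollary of the Main Theorem); held text
arXiv:math/0606088, chunks c5 L16 and c7 L11]. Everything in this file is PROVED (no named fact,
no `sorry`); the only analytic input is the tree's THEOREM
`Literature.NumberTheory.Sieve.GreenTao2010_mainTheorem_of_le_three` (the Main Theorem for
`t ≤ 3`, `LinearEquationsInPrimesThreeForms.lean`), whose own inputs are proved in the tree. The
threshold `N₀` is ineffective (Siegel–Walfisz enters the Green–Tao major arcs), as in Vinogradov's
original theorem; this file does NOT discharge parity.S11
`exists_prime_add_prime_add_prime_eq_of_odd` (Helfgott: all odd `n > 5`), whose docstring in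
`ParityWave0.lean` asks for exactly the present theorem "as a proved `theorem`, not as a further
named fact".

Contents (the dictionary W1–W7 between the ternary problem and the Green–Tao data, then the
compositions):

* `ternarySystem N = (n₁, n₂, N − n₁ − n₂)`, `ternaryBody N = {x₁, x₂ ≥ 0, x₁ + x₂ ≤ N}`;
* W1 `ternarySystem_isNondegenerate`, `ternarySystem_isFiniteComplexity`; W2 `affLinSize_ternarySystem_le`;
  W3 `convex_ternaryBody`, `ternaryBody_subset_realBox`; W4 `vonMangoldtSum_ternarySystem`
  (`= weightedTernaryCount N = Σ_{n₁+n₂+n₃=N} Λ(n₁)Λ(n₂)Λ(n₃)`); W5 `archFactor_ternarySystem`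
  (`β_∞ = N²/2`); W6 `one_le_singularProduct_ternarySystem` (odd `N`); W7
  `singularProduct_ternarySystem` (`= ternaryGoldbachSingularSeries N`, the tree's singular series
  of `SingularSeries.lean`, for `N ≠ 0`; at `N = 0` the two sides differ).
* Compositions: `weightedTernaryCount_asymptotic_singularProduct`, `weightedTernaryCount_asymptotic`
  (`R₃(N) = ½𝔖₃(N)N² + o(N²)`), `vinogradov_three_primes` (prime powers removed with the tree's
  `exists_three_primes_of_lt_weightedTernaryCount'`, `ParityWave0TernaryGoldbachProofs.lean`).

Provenance: written in the ideation cell `parity-ideate` (planner seat p2, 2026-08-25, evidence file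
`VinogradovThreePrimes.lean`, refereed there); landed unchanged except for this docstring by the
cell's literature seat. Template followed: `LinearEquationsInPrimesTwinSystem.lean`.

## References

* I. M. Vinogradov, *Representation of an odd number as a sum of three primes*, Dokl. Akad. Nauk
  SSSR 15 (1937), 291–294. [Vinogradov1937] [Vinogradov1937ThreePrimes]
* M. B. Nathanson, *Additive Number Theory: The Classical Bases*, GTM 164, Springer (1996), Ch. 8,
  Theorems 8.1, 8.7 (held text, `lit read book:nathanson1996-additive-number-theory`, chunks
  p0133, p0142). [Nathanson1996]
* R. C. Vaughan, *The Hardy–Littlewood Method*, Cambridge Tracts 80 (1981), Theorem 3.4.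
  [VaughanHL1981]
* B. Green, T. Tao, *Linear equations in primes*, Ann. of Math. (2) 171 (2010), 1753–1850,
  §1 Examples 1, Cor. 1.7, Main Theorem (`lit read arxiv:math/0606088`, chunks c5, c7). [GreenTao2010]
-/

noncomputable section

open Filter Finset MeasureTheory
open scoped Topology ArithmeticFunction.vonMangoldt

namespace Literature.NumberTheory.Sieve

/-- The ternary Goldbach system `Ψ_N(n₁, n₂) = (n₁, n₂, N − n₁ − n₂)` (`d = 2`, `t = 3`).
[cite: GreenTao2010, Cor. 1.7 and Examples 1] -/
def ternarySystem (N : ℕ) : Fin 3 → AffLinForm 2 :=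
  ![⟨![1, 0], 0⟩, ⟨![0, 1], 0⟩, ⟨![-1, -1], (N : ℤ)⟩]

/-- The triangle `K_N = {x ∈ ℝ² : 0 ≤ x₁, 0 ≤ x₂, x₁ + x₂ ≤ N}`. [folklore] -/
def ternaryBody (N : ℕ) : Set (Fin 2 → ℝ) :=
  {x | 0 ≤ x 0 ∧ 0 ≤ x 1 ∧ x 0 + x 1 ≤ (N : ℝ)}

/-! ### Evaluations -/

/-- `ψ₁(n) = n₁` for the ternary system. [cite: GreenTao2010, Examples 1] -/
@[simp] theorem ternarySystem_eval_zero (N : ℕ) (n : Fin 2 → ℤ) :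
    (ternarySystem N 0).eval n = n 0 := by
  simp [ternarySystem, AffLinForm.eval, Fin.sum_univ_two]

/-- `ψ₂(n) = n₂` for the ternary system. [cite: GreenTao2010, Examples 1] -/
@[simp] theorem ternarySystem_eval_one (N : ℕ) (n : Fin 2 → ℤ) :
    (ternarySystem N 1).eval n = n 1 := by
  simp [ternarySystem, AffLinForm.eval, Fin.sum_univ_two]

/-- `ψ₃(n) = N − n₁ − n₂` for the ternary system. [cite: GreenTao2010, Examples 1] -/
@[simp] theorem ternarySystem_eval_two (N : ℕ) (n : Fin 2 → ℤ) :
    (ternarySystem N 2).eval n = -n 0 - n 1 + N := by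
  simp [ternarySystem, AffLinForm.eval, Fin.sum_univ_two]; ring

/-- `ψ₁(x) = x₁` on `ℝ²` for the ternary system. [cite: GreenTao2010, Examples 1] -/
@[simp] theorem ternarySystem_realEval_zero (N : ℕ) (x : Fin 2 → ℝ) :
    (ternarySystem N 0).realEval x = x 0 := by
  simp [ternarySystem, AffLinForm.realEval, Fin.sum_univ_two]

/-- `ψ₂(x) = x₂` on `ℝ²` for the ternary system. [cite: GreenTao2010, Examples 1] -/
@[simp] theorem ternarySystem_realEval_one (N : ℕ) (x : Fin 2 → ℝ) :
    (ternarySystem N 1).realEval x = x 1 := by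
  simp [ternarySystem, AffLinForm.realEval, Fin.sum_univ_two]

/-- `ψ₃(x) = N − x₁ − x₂` on `ℝ²` for the ternary system. [cite: GreenTao2010, Examples 1] -/
@[simp] theorem ternarySystem_realEval_two (N : ℕ) (x : Fin 2 → ℝ) :
    (ternarySystem N 2).realEval x = -x 0 - x 1 + N := by
  simp [ternarySystem, AffLinForm.realEval, Fin.sum_univ_two]; ring

/-! ### W1: standing hypotheses and finite complexity -/

/-- W1a. `Ψ_N` satisfies Green–Tao's standing hypotheses. [cite: GreenTao2010, Def. 1.1, Examples 1] -/
theorem ternarySystem_isNondegenerate (N : ℕ) : IsNondegenerateSystem (ternarySystem N) := by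
  refine ⟨fun i => ?_, fun i j hij a b hab => ?_⟩
  · fin_cases i <;> simp [ternarySystem, funext_iff, Fin.forall_fin_two]
  · have h10 := hab ![1, 0]
    have h01 := hab ![0, 1]
    have h20 := hab ![2, 0]
    have h02 := hab ![0, 2]
    fin_cases i <;> fin_cases j <;>
      simp only [Fin.isValue, Fin.zero_eta, Fin.mk_one, Fin.reduceFinMk, ternarySystem_eval_zero,
        ternarySystem_eval_one, ternarySystem_eval_two, Matrix.cons_val_zero, Matrix.cons_val_one,
        ne_eq, not_true_eq_false] at hij h10 h01 h20 h02 ⊢ <;>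
      (constructor <;> nlinarith [h10, h01, h20, h02])

/-- W1b. `Ψ_N` has finite complexity: the linear parts `(1,0), (0,1), (−1,−1)` are pairwise
non-parallel. [cite: GreenTao2010, Def. 1.5, Cor. 1.7, Examples 1] -/
theorem ternarySystem_isFiniteComplexity (N : ℕ) : IsFiniteComplexitySystem (ternarySystem N) := by
  intro i j hij a b hab
  have h0 := congr_fun hab 0
  have h1 := congr_fun hab 1
  fin_cases i <;> fin_cases j <;>
    simp only [Fin.isValue, Fin.zero_eta, Fin.mk_one, Fin.reduceFinMk, ternarySystem,
      Matrix.cons_val_zero, Matrix.cons_val_one, Matrix.cons_val_two, Matrix.head_cons,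
      Matrix.tail_cons, Pi.smul_apply, smul_eq_mul, mul_one, mul_zero, mul_neg, ne_eq,
      not_true_eq_false] at hij h0 h1 ⊢ <;>
    omega

/-! ### W2: size -/

/-- W2. `‖Ψ_N‖_N = 4 + |N/N| ≤ 5` for `N ≥ 1`. [cite: GreenTao2010, (1.1)] -/
theorem affLinSize_ternarySystem_le {N : ℕ} (hN : 1 ≤ N) :
    affLinSize (ternarySystem N) (N : ℝ) ≤ 5 := by
  have hN0 : (0 : ℝ) < N := by exact_mod_cast hN
  unfold affLinSize
  simp only [Fin.sum_univ_three, Fin.sum_univ_two, ternarySystem, Matrix.cons_val_zero,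
    Matrix.cons_val_one, Matrix.cons_val_two, Matrix.head_cons, Matrix.tail_cons, Int.cast_one,
    abs_one, Int.cast_zero, abs_zero, zero_div, Int.cast_neg, abs_neg, Int.cast_natCast,
    div_self hN0.ne']
  norm_num

/-! ### W3: the body -/

/-- W3a. `K_N` is convex (the hypothesis "`K ⊆ [−N,N]^d` convex" of the Main Theorem for the ternary body). [cite: GreenTao2010, Main Theorem and Cor. 1.7] -/
theorem convex_ternaryBody (N : ℕ) : Convex ℝ (ternaryBody N) := by
  intro x hx y hy a b ha hb hab
  simp only [ternaryBody, Set.mem_setOf_eq, Pi.add_apply, Pi.smul_apply, smul_eq_mul] at hx hy ⊢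
  refine ⟨by nlinarith [mul_nonneg ha hx.1, mul_nonneg hb hy.1],
    by nlinarith [mul_nonneg ha hx.2.1, mul_nonneg hb hy.2.1], ?_⟩
  nlinarith [mul_le_mul_of_nonneg_left hx.2.2 ha, mul_le_mul_of_nonneg_left hy.2.2 hb]

/-- W3b. `K_N ⊆ [−N, N]²` (the hypothesis "`K ⊆ [−N,N]^d`" of the Main Theorem for the ternary body). [cite: GreenTao2010, Main Theorem and Cor. 1.7] -/
theorem ternaryBody_subset_realBox (N : ℕ) : ternaryBody N ⊆ realBox 2 N := by
  intro x hx
  simp only [ternaryBody, Set.mem_setOf_eq] at hx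
  have hN : (0 : ℝ) ≤ N := Nat.cast_nonneg N
  simp only [realBox, Set.mem_Icc, Pi.le_def, Fin.forall_fin_two]
  exact ⟨⟨by linarith, by linarith⟩, by linarith, by linarith⟩

/-! ### W5: the archimedean factor -/

/-- W5. `β_∞(Ψ_N, K_N) = vol{x₁ > 0, x₂ > 0, x₁ + x₂ < N} = N²/2`. [cite: GreenTao2010, (1.4)] -/
theorem archFactor_ternarySystem (N : ℕ) :
    archFactor (ternarySystem N) (ternaryBody N) = (N : ℝ) ^ 2 / 2 := by
  unfold archFactor
  have hN : (0 : ℝ) ≤ N := Nat.cast_nonneg N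
  -- the positive part of the body is the open triangle
  set T : Set (ℝ × ℝ) := regionBetween (fun _ => (0 : ℝ)) (fun a => (N : ℝ) - a) (Set.Ioo 0 N)
    with hT
  have hset : ternaryBody N ∩ {x | ∀ i, 0 < (ternarySystem N i).realEval x} =
      MeasurableEquiv.finTwoArrow ⁻¹' T := by
    ext x
    simp only [ternaryBody, Set.mem_inter_iff, Set.mem_setOf_eq, Fin.forall_fin_succ,
      IsEmpty.forall_iff, and_true, ternarySystem_realEval_zero,
      Set.mem_preimage, hT, regionBetween, Set.mem_Ioo, MeasurableEquiv.finTwoArrow_apply]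
    simp only [Fin.succ_zero_eq_one, Fin.succ_one_eq_two, ternarySystem_realEval_one,
      ternarySystem_realEval_two]
    constructor
    · rintro ⟨-, h0, h1, h2⟩
      exact ⟨⟨h0, by linarith⟩, h1, by linarith⟩
    · rintro ⟨⟨h0, -⟩, h1, h2⟩
      exact ⟨⟨h0.le, h1.le, by linarith⟩, h0, h1, by linarith⟩
  rw [hset, (volume_preserving_finTwoArrow ℝ).measure_preimage]
  swap
  · exact (measurableSet_regionBetween measurable_const (measurable_const.sub measurable_id)
      measurableSet_Ioo).nullMeasurableSet
  have f_int : IntegrableOn (fun _ : ℝ => (0 : ℝ)) (Set.Ioo 0 (N : ℝ)) volume :=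
    (continuous_const).integrableOn_Icc.mono_set Set.Ioo_subset_Icc_self
  have g_int : IntegrableOn (fun a : ℝ => (N : ℝ) - a) (Set.Ioo 0 (N : ℝ)) volume :=
    (by fun_prop : Continuous fun a : ℝ => (N : ℝ) - a).integrableOn_Icc.mono_set
      Set.Ioo_subset_Icc_self
  rw [show (volume : Measure (ℝ × ℝ)) = volume.prod volume from rfl, hT,
    volume_regionBetween_eq_integral f_int g_int measurableSet_Ioo
      (fun a ha => by simp only [Set.mem_Ioo] at ha; linarith)]
  have hint : ∫ y in Set.Ioo (0 : ℝ) N, ((fun a : ℝ => (N : ℝ) - a) - fun _ : ℝ => (0 : ℝ)) y =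
      (N : ℝ) ^ 2 / 2 := by
    simp only [Pi.sub_apply, sub_zero]
    rw [← integral_Ioc_eq_integral_Ioo, ← intervalIntegral.integral_of_le hN,
      intervalIntegral.integral_sub intervalIntegrable_const intervalIntegral.intervalIntegrable_id,
      intervalIntegral.integral_const, integral_id]
    simp; ring
  rw [hint, ENNReal.toReal_ofReal (by positivity)]

/-! ### W4: the weighted sum is `R₃(N)` -/

/-- W4. `∑_{n ∈ K_N ∩ ℤ²} Λ(n₁)Λ(n₂)Λ(N−n₁−n₂) = R₃(N) = ∑_{n₁+n₂+n₃=N} Λ(n₁)Λ(n₂)Λ(n₃)`.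
[cite: GreenTao2010, (1.2), Examples 1] -/
theorem vonMangoldtSum_ternarySystem (N : ℕ) :
    vonMangoldtSum (ternarySystem N) (ternaryBody N) N = weightedTernaryCount N := by
  classical
  unfold vonMangoldtSum weightedTernaryCount
  -- the lattice points of `K_N`
  have hmem : ∀ n : Fin 2 → ℤ, n ∈ (latticeBox 2 N).filter (fun n => realPoint n ∈ ternaryBody N) ↔
      0 ≤ n 0 ∧ 0 ≤ n 1 ∧ n 0 + n 1 ≤ N := by
    intro n
    simp only [Finset.mem_filter, latticeBox, Fintype.mem_piFinset, Finset.mem_Icc, ternaryBody,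
      Set.mem_setOf_eq, realPoint, Fin.forall_fin_two]
    constructor
    · rintro ⟨-, h0, h1, h2⟩
      refine ⟨by exact_mod_cast h0, by exact_mod_cast h1, by exact_mod_cast h2⟩
    · rintro ⟨h0, h1, h2⟩
      refine ⟨⟨⟨by omega, by omega⟩, by omega, by omega⟩, by exact_mod_cast h0, by exact_mod_cast h1,
        by exact_mod_cast h2⟩
  refine Finset.sum_nbij' (fun n => ![(n 0).toNat, (n 1).toNat, N - (n 0).toNat - (n 1).toNat])
    (fun m => ![(m 0 : ℤ), (m 1 : ℤ)]) (fun n hn => ?_) (fun m hm => ?_) (fun n hn => ?_)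
    (fun m hm => ?_) (fun n hn => ?_)
  · rw [hmem] at hn
    rw [Finset.Nat.mem_antidiagonalTuple, Fin.sum_univ_three]
    simp only [Matrix.cons_val_zero, Matrix.cons_val_one, Matrix.cons_val_two, Matrix.head_cons,
      Matrix.tail_cons]
    omega
  · rw [Finset.Nat.mem_antidiagonalTuple, Fin.sum_univ_three] at hm
    rw [hmem]
    simp only [Matrix.cons_val_zero, Matrix.cons_val_one]
    omega
  · rw [hmem] at hn
    funext i
    fin_cases i <;> simp <;> omega
  · rw [Finset.Nat.mem_antidiagonalTuple, Fin.sum_univ_three] at hm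
    funext i
    fin_cases i <;> simp; omega
  · rw [hmem] at hn
    rw [Fin.prod_univ_three, Fin.prod_univ_three]
    simp only [ternarySystem_eval_zero, ternarySystem_eval_one, ternarySystem_eval_two, intVonMangoldt,
      Matrix.cons_val_zero, Matrix.cons_val_one, Matrix.cons_val_two, Matrix.head_cons,
      Matrix.tail_cons]
    congr 2
    omega

/-! ### W6/W7: local factors `β_p(Ψ_N)` -/

/-- `ψ₁ ≡ v₁` modulo `p` for the ternary system. [cite: GreenTao2010, Examples 1] -/
theorem ternarySystem_modEval_zero {p : ℕ} (N : ℕ) (v : Fin 2 → ZMod p) :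
    (ternarySystem N 0).modEval p v = v 0 := by
  simp [ternarySystem, AffLinForm.modEval, Fin.sum_univ_two]

/-- `ψ₂ ≡ v₂` modulo `p` for the ternary system. [cite: GreenTao2010, Examples 1] -/
theorem ternarySystem_modEval_one {p : ℕ} (N : ℕ) (v : Fin 2 → ZMod p) :
    (ternarySystem N 1).modEval p v = v 1 := by
  simp [ternarySystem, AffLinForm.modEval, Fin.sum_univ_two]

/-- `ψ₃ ≡ N − v₁ − v₂` modulo `p` for the ternary system. [cite: GreenTao2010, Examples 1] -/
theorem ternarySystem_modEval_two {p : ℕ} (N : ℕ) (v : Fin 2 → ZMod p) :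
    (ternarySystem N 2).modEval p v = -v 0 - v 1 + (N : ZMod p) := by
  simp [ternarySystem, AffLinForm.modEval, Fin.sum_univ_two]; ring

/-- For `a ≠ 0` in `ℤ/p`: `#{b : b ≢ 0, N - a - b ≢ 0 (p)} = p - #{0, N - a}`. [folklore] -/
private theorem card_filter_ternaryFiber {p : ℕ} [hp : Fact p.Prime] (N : ℕ) {a : ZMod p} (ha : a ≠ 0) :
    #{b : ZMod p | a ≠ 0 ∧ b ≠ 0 ∧ -a - b + (N : ZMod p) ≠ 0} =
      if a = (N : ZMod p) then p - 1 else p - 2 := by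
  classical
  have hset : (Finset.univ.filter fun b : ZMod p => a ≠ 0 ∧ b ≠ 0 ∧ -a - b + (N : ZMod p) ≠ 0) =
      Finset.univ \ {0, (N : ZMod p) - a} := by
    ext b
    simp only [Finset.mem_filter, Finset.mem_univ, true_and, Finset.mem_sdiff, Finset.mem_insert,
      Finset.mem_singleton, not_or, ne_eq, ha, not_false_eq_true]
    constructor
    · rintro ⟨hb, hab⟩
      exact ⟨hb, fun h => hab (by rw [h]; ring)⟩
    · rintro ⟨hb, hab⟩
      exact ⟨hb, fun h => hab (by linear_combination -h)⟩
  rw [hset, Finset.card_univ_sdiff, ZMod.card]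
  by_cases haN : a = (N : ZMod p)
  · have h0 : (N : ZMod p) - a = 0 := by rw [haN, sub_self]
    rw [if_pos haN, h0, Finset.insert_eq_of_mem (Finset.mem_singleton_self _),
      Finset.card_singleton]
  · have hne : (0 : ZMod p) ≠ (N : ZMod p) - a := by
      intro h; exact haN (by linear_combination h)
    rw [if_neg haN, Finset.card_pair hne]

/-- `#{n ∈ (ℤ/p)² : n₁, n₂, N − n₁ − n₂ ≢ 0} = (p-1)(p-2) + [p ∤ N]`. [folklore] -/
private theorem goodCount_ternarySystem {p : ℕ} [hp : Fact p.Prime] (N : ℕ) :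
    goodCount (ternarySystem N) p = (p - 1) * (p - 2) + (if p ∣ N then 0 else 1) := by
  classical
  unfold goodCount
  -- transfer to pairs `(a, b) = (v 0, v 1)`
  have h1 : #{v : Fin 2 → ZMod p | ∀ i, ¬ (ternarySystem N i).modEval p v = 0} =
      #((Finset.univ ×ˢ Finset.univ).filter fun ab : ZMod p × ZMod p =>
          ab.1 ≠ 0 ∧ ab.2 ≠ 0 ∧ -ab.1 - ab.2 + (N : ZMod p) ≠ 0) := by
    refine Finset.card_nbij' (fun v => (v 0, v 1)) (fun ab => ![ab.1, ab.2]) (fun v hv => ?_)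
      (fun ab hab => ?_) (fun v _ => ?_) (fun ab _ => ?_)
    · simp only [Finset.coe_filter, Finset.mem_univ, true_and, Set.mem_setOf_eq,
        Fin.forall_fin_succ, IsEmpty.forall_iff, and_true, Fin.succ_zero_eq_one,
        Fin.succ_one_eq_two, ternarySystem_modEval_zero, ternarySystem_modEval_one,
        ternarySystem_modEval_two] at hv
      simp only [Finset.coe_filter, Finset.mem_product, Finset.mem_univ, true_and,
        Set.mem_setOf_eq, ne_eq]
      exact hv
    · simp only [Finset.coe_filter, Finset.mem_product, Finset.mem_univ, true_and,
        Set.mem_setOf_eq, ne_eq] at hab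
      simp only [Finset.coe_filter, Finset.mem_univ, true_and, Set.mem_setOf_eq,
        Fin.forall_fin_succ, IsEmpty.forall_iff, and_true, Fin.succ_zero_eq_one,
        Fin.succ_one_eq_two, ternarySystem_modEval_zero, ternarySystem_modEval_one,
        ternarySystem_modEval_two, Matrix.cons_val_zero, Matrix.cons_val_one]
      exact hab
    · funext i; fin_cases i <;> simp
    · simp
  rw [h1, Finset.card_filter, Finset.sum_product]
  -- the fibres over `a`
  have h2 : ∀ a : ZMod p,
      (∑ b : ZMod p, if (a ≠ 0 ∧ b ≠ 0 ∧ -a - b + (N : ZMod p) ≠ 0) then 1 else 0) =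
        if a = 0 then 0 else (if a = (N : ZMod p) then p - 1 else p - 2) := by
    intro a
    by_cases ha : a = 0
    · simp [ha]
    · rw [if_neg ha, ← card_filter_ternaryFiber N ha, Finset.card_filter]
  rw [Finset.sum_congr rfl fun a _ => h2 a, ← Finset.add_sum_erase _ _ (Finset.mem_univ (0 : ZMod p)),
    if_pos rfl, zero_add]
  have hcardE : #(Finset.univ.erase (0 : ZMod p)) = p - 1 := by
    rw [Finset.card_erase_of_mem (Finset.mem_univ _), Finset.card_univ, ZMod.card]
  have hE : ∀ a ∈ Finset.univ.erase (0 : ZMod p),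
      (if a = 0 then 0 else (if a = (N : ZMod p) then p - 1 else p - 2)) =
        (if a = (N : ZMod p) then p - 1 else p - 2) := by
    intro a ha
    rw [if_neg (Finset.ne_of_mem_erase ha)]
  rw [Finset.sum_congr rfl hE]
  obtain ⟨q, hq⟩ : ∃ q, p = q + 2 := ⟨p - 2, by have := hp.out.two_le; omega⟩
  by_cases hpN : p ∣ N
  · -- `N ≡ 0`: every `a ≠ 0` contributes `p - 2`
    have hN0 : (N : ZMod p) = 0 := (ZMod.natCast_eq_zero_iff N p).mpr hpN
    have hE' : ∀ a ∈ Finset.univ.erase (0 : ZMod p),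
        (if a = (N : ZMod p) then p - 1 else p - 2) = p - 2 := by
      intro a ha
      rw [hN0, if_neg (Finset.ne_of_mem_erase ha)]
    rw [Finset.sum_congr rfl hE', Finset.sum_const, hcardE, smul_eq_mul, if_pos hpN, add_zero]
  · -- `N ≢ 0`: the fibre over `a = N` contributes `p - 1`, the other `p - 2` fibres `p - 2` each
    have hN0 : (N : ZMod p) ≠ 0 := fun h => hpN ((ZMod.natCast_eq_zero_iff N p).mp h)
    have hNmem : (N : ZMod p) ∈ Finset.univ.erase (0 : ZMod p) :=
      Finset.mem_erase.mpr ⟨hN0, Finset.mem_univ _⟩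
    rw [← Finset.add_sum_erase _ _ hNmem, if_pos rfl]
    have hE' : ∀ a ∈ (Finset.univ.erase (0 : ZMod p)).erase (N : ZMod p),
        (if a = (N : ZMod p) then p - 1 else p - 2) = p - 2 := by
      intro a ha
      rw [if_neg (Finset.ne_of_mem_erase ha)]
    rw [Finset.sum_congr rfl hE', Finset.sum_const, Finset.card_erase_of_mem hNmem, hcardE,
      smul_eq_mul, if_neg hpN, hq]
    simp only [Nat.add_sub_cancel, show q + 2 - 1 = q + 1 by omega, show q + 1 - 1 = q by omega]
    ring

/-- `β_p(Ψ_N) = 1 - 1/(p-1)²` if `p ∣ N`. [cite: VaughanHL1997, Thm. 3.4] -/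
theorem localFactor_ternarySystem_of_dvd {p N : ℕ} (hp : p.Prime) (hpN : p ∣ N) :
    localFactor (ternarySystem N) p = 1 - 1 / ((p : ℝ) - 1) ^ 2 := by
  haveI := Fact.mk hp
  rw [localFactor_prime, goodCount_ternarySystem, if_pos hpN, add_zero, Nat.cast_mul,
    Nat.cast_sub hp.two_le, Nat.cast_sub hp.one_le]
  have hp2 : (2 : ℝ) ≤ p := by exact_mod_cast hp.two_le
  have hp1 : (p : ℝ) - 1 ≠ 0 := by linarith
  have hp0 : (p : ℝ) ≠ 0 := by linarith
  push_cast
  field_simp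
  ring

/-- `β_p(Ψ_N) = 1 + 1/(p-1)³` if `p ∤ N` (in particular `β₂ = 2` for odd `N`).
[cite: VaughanHL1997, Thm. 3.4] -/
theorem localFactor_ternarySystem_of_not_dvd {p N : ℕ} (hp : p.Prime) (hpN : ¬ p ∣ N) :
    localFactor (ternarySystem N) p = 1 + 1 / ((p : ℝ) - 1) ^ 3 := by
  haveI := Fact.mk hp
  rw [localFactor_prime, goodCount_ternarySystem, if_neg hpN, Nat.cast_add, Nat.cast_mul,
    Nat.cast_sub hp.two_le, Nat.cast_sub hp.one_le]
  have hp2 : (2 : ℝ) ≤ p := by exact_mod_cast hp.two_le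
  have hp1 : (p : ℝ) - 1 ≠ 0 := by linarith
  have hp0 : (p : ℝ) ≠ 0 := by linarith
  push_cast
  field_simp
  ring

/-- `β_p(Ψ_N) ≥ 1 - 1/(p-1)²` for every prime `p`. [folklore] -/
private theorem one_sub_le_localFactor_ternarySystem {p : ℕ} (N : ℕ) (hp : p.Prime) :
    1 - 1 / ((p : ℝ) - 1) ^ 2 ≤ localFactor (ternarySystem N) p := by
  by_cases hpN : p ∣ N
  · rw [localFactor_ternarySystem_of_dvd hp hpN]
  · rw [localFactor_ternarySystem_of_not_dvd hp hpN]
    have hp2 : (2 : ℝ) ≤ p := by exact_mod_cast hp.two_le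
    have hq : 0 < (p : ℝ) - 1 := by linarith
    have h1 : 0 ≤ 1 / ((p : ℝ) - 1) ^ 2 := by positivity
    have h2 : 0 ≤ 1 / ((p : ℝ) - 1) ^ 3 := by positivity
    linarith

/-! ### W6: `𝔖(Ψ_N) ≥ 1` for odd `N` -/

/-- `∏_{p ≤ x} β_p(Ψ_N) ≥ 1` for odd `N` and `x ≥ 2`: `β₂ = 2` and
`∏_{2 < p ≤ x} β_p ≥ ∏_{2 < p ≤ x} (1 - 1/(p-1)²) ≥ ∏_{m=2}^{x} (1 - 1/m²) = (x+1)/(2x) ≥ 1/2`.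
[cite: VaughanHL1997, Thm. 3.4] -/
theorem one_le_singularProductPartial_ternarySystem {N : ℕ} (hN : Odd N) {x : ℕ} (hx : 2 ≤ x) :
    1 ≤ singularProductPartial (ternarySystem N) x := by
  unfold singularProductPartial
  have h2mem : 2 ∈ Nat.primesLE x := Nat.mem_primesLE.mpr ⟨hx, Nat.prime_two⟩
  have h2N : ¬ 2 ∣ N := by
    intro h; exact (Nat.not_even_iff_odd.mpr hN) (even_iff_two_dvd.mpr h)
  have hβ2 : localFactor (ternarySystem N) 2 = 2 := by
    rw [localFactor_ternarySystem_of_not_dvd Nat.prime_two h2N]; norm_num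
  rw [← Finset.mul_prod_erase _ _ h2mem, hβ2]
  set P := (Nat.primesLE x).erase 2 with hP
  have hPmem : ∀ p ∈ P, p.Prime ∧ p ≠ 2 ∧ p ≤ x := by
    intro p hp
    obtain ⟨hp2, hp'⟩ := Finset.mem_erase.mp hp
    obtain ⟨hpx, hpp⟩ := Nat.mem_primesLE.mp hp'
    exact ⟨hpp, hp2, hpx⟩
  have hlow : ∏ p ∈ P, (1 - 1 / ((p : ℝ) - 1) ^ 2) ≤ ∏ p ∈ P, localFactor (ternarySystem N) p := by
    refine Finset.prod_le_prod (fun p hp => ?_) (fun p hp => ?_)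
    · obtain ⟨hpp, hp2, -⟩ := hPmem p hp
      have := hpp.two_le
      exact twinPrimeConstFactor_nonneg (by omega)
    · exact one_sub_le_localFactor_ternarySystem N (hPmem p hp).1
  -- reindex by `p ↦ p - 1` (verbatim from the twin-prime template)
  have hinj : Set.InjOn (fun p : ℕ => (p - 1 : ℕ)) P := by
    intro p hp q hq h
    have := (hPmem p hp).1.one_le
    have := (hPmem q hq).1.one_le
    simp only at h
    omega
  have himage : ∏ p ∈ P, (1 - 1 / ((p : ℝ) - 1) ^ 2) =
      ∏ m ∈ P.image (fun p : ℕ => (p - 1 : ℕ)), (1 - 1 / ((m : ℕ) : ℝ) ^ 2) := by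
    rw [Finset.prod_image hinj]
    refine Finset.prod_congr rfl fun p hp => ?_
    rw [Nat.cast_sub (hPmem p hp).1.one_le, Nat.cast_one]
  have hsub : P.image (fun p : ℕ => (p - 1 : ℕ)) ⊆ Icc 2 x := by
    intro m hm
    obtain ⟨p, hp, rfl⟩ := Finset.mem_image.mp hm
    obtain ⟨hpp, hp2, hpx⟩ := hPmem p hp
    have := hpp.two_le
    exact Finset.mem_Icc.mpr ⟨by omega, by omega⟩
  have hle : ∏ m ∈ Icc 2 x, (1 - 1 / ((m : ℕ) : ℝ) ^ 2) ≤
      ∏ m ∈ P.image (fun p : ℕ => (p - 1 : ℕ)), (1 - 1 / ((m : ℕ) : ℝ) ^ 2) := by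
    refine Finset.prod_le_prod_of_subset_of_le_one hsub (fun m hm => ?_) (fun m hm _ => ?_)
    · have hm2 : (2 : ℝ) ≤ m := by exact_mod_cast (Finset.mem_Icc.mp hm).1
      have : 1 / (m : ℝ) ^ 2 ≤ 1 := by
        rw [div_le_one (by positivity)]; nlinarith
      linarith
    · have : 0 ≤ 1 / (m : ℝ) ^ 2 := by positivity
      linarith
  rw [prod_Icc_two_one_sub_one_div_sq (by omega)] at hle
  have hx' : (2 : ℝ) ≤ x := by exact_mod_cast hx
  have hhalf : (1 : ℝ) / 2 ≤ ((x : ℝ) + 1) / (2 * x) := by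
    rw [div_le_div_iff₀ (by norm_num) (by positivity)]; linarith
  rw [← himage] at hle
  linarith

/-- **W6.** `𝔖(Ψ_N) = ∏_p β_p(Ψ_N) ≥ 1` for odd `N` (limit of the ordered partial products,
`tendsto_singularProductPartial_holds`). [cite: VaughanHL1997, Thm. 3.4] -/
theorem one_le_singularProduct_ternarySystem {N : ℕ} (hN : Odd N) :
    1 ≤ singularProduct (ternarySystem N) :=
  ge_of_tendsto (tendsto_singularProductPartial_holds 2 3 (ternarySystem N)
    (ternarySystem_isNondegenerate N))
    (eventually_atTop.2 ⟨2, fun _ hx => one_le_singularProductPartial_ternarySystem hN hx⟩)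

/-! ### W7: `𝔖(Ψ_N) = 𝔖₃(N)` -/

/-- For `N ≠ 0` and `x ≥ N`:
`∏_{p ≤ x} β_p(Ψ_N) = (∏_{p ≤ x} (1 + (p-1)⁻³)) · ∏_{p ∣ N} (1 - (p² - 3p + 3)⁻¹)`, by the identity
`(1 + (p-1)⁻³)(1 - (p²-3p+3)⁻¹) = 1 - (p-1)⁻²`. [cite: VaughanHL1997, (3.14)–(3.15)] -/
theorem singularProductPartial_ternarySystem {N : ℕ} (hN : N ≠ 0) {x : ℕ} (hx : N ≤ x) :
    singularProductPartial (ternarySystem N) x =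
      (∏ p ∈ Nat.primesLE x, (1 + 1 / ((p : ℝ) - 1) ^ 3)) *
        ∏ p ∈ N.primeFactors, (1 - 1 / ((p : ℝ) ^ 2 - 3 * p + 3)) := by
  unfold singularProductPartial
  have hfac : ∀ p ∈ Nat.primesLE x, localFactor (ternarySystem N) p =
      (1 + 1 / ((p : ℝ) - 1) ^ 3) *
        (if p ∣ N then (1 - 1 / ((p : ℝ) ^ 2 - 3 * p + 3)) else 1) := by
    intro p hp
    have hpp := (Nat.mem_primesLE.mp hp).2
    by_cases hpN : p ∣ N
    · rw [if_pos hpN, localFactor_ternarySystem_of_dvd hpp hpN]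
      have hp2 : (2 : ℝ) ≤ p := by exact_mod_cast hpp.two_le
      have h1 : (p : ℝ) - 1 ≠ 0 := by linarith
      have h2 : (p : ℝ) ^ 2 - 3 * p + 3 ≠ 0 := by nlinarith
      have h3 : ((p : ℝ) - 1) ^ 3 ≠ 0 := pow_ne_zero 3 h1
      rw [one_sub_div (pow_ne_zero 2 h1), one_add_div h3, one_sub_div h2, div_mul_div_comm,
        div_eq_div_iff (pow_ne_zero 2 h1) (mul_ne_zero h3 h2)]
      ring
    · rw [if_neg hpN, localFactor_ternarySystem_of_not_dvd hpp hpN, mul_one]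
  rw [Finset.prod_congr rfl hfac, Finset.prod_mul_distrib, ← Finset.prod_filter]
  congr 1
  refine Finset.prod_congr ?_ fun _ _ => rfl
  ext p
  simp only [Finset.mem_filter, Nat.mem_primesLE, Nat.mem_primeFactors]
  constructor
  · rintro ⟨⟨-, hpp⟩, hpN⟩
    exact ⟨hpp, hpN, hN⟩
  · rintro ⟨hpp, hpN, -⟩
    exact ⟨⟨(Nat.le_of_dvd (Nat.pos_of_ne_zero hN) hpN).trans hx, hpp⟩, hpN⟩

/-- Partial products over `p ≤ n` of a function multipliable over the primes tend to its `∏'`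
(multiplicative twin of `tendsto_sum_primesLE_of_summable`). [folklore] -/
private theorem tendsto_prod_primesLE_of_multipliable {F : ℕ → ℝ}
    (hF : Multipliable fun p : Nat.Primes => F p) :
    Tendsto (fun n => ∏ p ∈ Nat.primesLE n, F p) atTop (𝓝 (∏' p : Nat.Primes, F p)) := by
  have h1 : ∏' p : Nat.Primes, F p = ∏' n : ℕ, {p : ℕ | p.Prime}.mulIndicator F n :=
    tprod_subtype {p : ℕ | p.Prime} F
  have h2 : Multipliable ({p : ℕ | p.Prime}.mulIndicator F) :=
    multipliable_subtype_iff_mulIndicator.mp hF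
  rw [h1]
  refine ((h2.tendsto_prod_tprod_nat).comp (tendsto_add_atTop_nat 1)).congr fun n => ?_
  simp only [Function.comp_def]
  rw [Nat.primesLE, Nat.primesBelow, Finset.prod_filter]
  refine Finset.prod_congr rfl fun k _ => ?_
  by_cases hk : k.Prime <;> simp [hk]

/-- **W7.** `𝔖(Ψ_N) = 𝔖₃(N) = ∏_p (1 + (p-1)⁻³) · ∏_{p ∣ N} (1 - (p²-3p+3)⁻¹)` for `N ≠ 0`
(for `N = 0` the left side vanishes since `β₂(Ψ₀) = 0`, while `𝔖₃(0) > 0` as typed).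
[cite: VaughanHL1997, Thm. 3.4] -/
theorem singularProduct_ternarySystem {N : ℕ} (hN : N ≠ 0) :
    singularProduct (ternarySystem N) = ternaryGoldbachSingularSeries N := by
  have hlim := tendsto_singularProductPartial_holds 2 3 (ternarySystem N)
    (ternarySystem_isNondegenerate N)
  have hlim2 : Tendsto (singularProductPartial (ternarySystem N)) atTop
      (𝓝 (ternaryGoldbachSingularSeries N)) := by
    unfold ternaryGoldbachSingularSeries
    have hT := (tendsto_prod_primesLE_of_multipliable (F := fun p : ℕ => 1 + 1 / ((p : ℝ) - 1) ^ 3)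
      multipliable_primes_one_add_one_div_sub_one_pow_three).mul_const
      (∏ p ∈ N.primeFactors, (1 - 1 / ((p : ℝ) ^ 2 - 3 * p + 3)))
    refine hT.congr' ?_
    filter_upwards [eventually_ge_atTop N] with x hx
    exact (singularProductPartial_ternarySystem hN hx).symm
  exact tendsto_nhds_unique hlim hlim2

/-! ### Compositions -/

/-- **Vinogradov's asymptotic with the Green–Tao singular product**:
`R₃(N) = ½ 𝔖(Ψ_N) N² + o(N²)`, from `GreenTao2010_mainTheorem_of_le_three` at `d = 2, t = 3, L = 5`.
[cite: GreenTao2010, Main Theorem, Cor. 1.7] -/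
theorem weightedTernaryCount_asymptotic_singularProduct :
    ∀ ε : ℝ, 0 < ε → ∃ N₀ : ℕ, ∀ N : ℕ, N₀ ≤ N →
      |weightedTernaryCount N - singularProduct (ternarySystem N) * (N : ℝ) ^ 2 / 2| ≤
        ε * (N : ℝ) ^ 2 := by
  intro ε hε
  obtain ⟨N₀, hN₀⟩ :=
    GreenTao2010_mainTheorem_of_le_three 2 3 5 (by norm_num) (by norm_num) le_rfl ε hε
  refine ⟨max N₀ 1, fun N hN => ?_⟩
  have hN₀N : N₀ ≤ N := le_trans (le_max_left _ _) hN
  have hN1 : 1 ≤ N := le_trans (le_max_right _ _) hN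
  have h := hN₀ N hN₀N (ternarySystem N) (ternarySystem_isNondegenerate N)
    (ternarySystem_isFiniteComplexity N) (affLinSize_ternarySystem_le hN1) (ternaryBody N)
    (convex_ternaryBody N) (ternaryBody_subset_realBox N)
  rw [vonMangoldtSum_ternarySystem, archFactor_ternarySystem] at h
  have e : (N : ℝ) ^ 2 / 2 * singularProduct (ternarySystem N) =
      singularProduct (ternarySystem N) * (N : ℝ) ^ 2 / 2 := by ring
  rw [e] at h
  exact h

/-- **Vinogradov 1937 / Vaughan Thm 3.4, with the printed singular series**:
`R₃(N) = ½ 𝔖₃(N) N² + o(N²)` (all `N`; informative for odd `N`, where `𝔖₃(N) ≥ 1`).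
[cite: Vinogradov1937] -/
theorem weightedTernaryCount_asymptotic :
    ∀ ε : ℝ, 0 < ε → ∃ N₀ : ℕ, ∀ N : ℕ, N₀ ≤ N →
      |weightedTernaryCount N - ternaryGoldbachSingularSeries N * (N : ℝ) ^ 2 / 2| ≤
        ε * (N : ℝ) ^ 2 := by
  intro ε hε
  obtain ⟨N₀, hN₀⟩ := weightedTernaryCount_asymptotic_singularProduct ε hε
  refine ⟨max N₀ 1, fun N hN => ?_⟩
  have hN0 : N ≠ 0 := by have := le_trans (le_max_right _ _) hN; omega
  rw [← singularProduct_ternarySystem hN0]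
  exact hN₀ N (le_trans (le_max_left _ _) hN)

/-- Growth bookkeeping for the prime-power removal: eventually
`6 (log 4 + 4) N √N (log N)² < 3N²/8` (`(log N)⁴ / N → 0`, Mathlib
`Real.tendsto_pow_log_div_mul_add_atTop`). [folklore] -/
private theorem eventually_chebyshevThreshold_lt :
    ∃ N₁ : ℕ, ∀ N : ℕ, N₁ ≤ N →
      6 * (Real.log 4 + 4) * N * Real.sqrt N * (Real.log N) ^ 2 < 3 * (N : ℝ) ^ 2 / 8 := by
  set c : ℝ := Real.log 4 + 4 with hc
  have hc0 : 0 < c := by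
    have : 0 ≤ Real.log 4 := Real.log_nonneg (by norm_num)
    rw [hc]; linarith
  have hc1 : c ≠ 0 := hc0.ne'
  have h := Real.tendsto_pow_log_div_mul_add_atTop 1 0 4 one_ne_zero
  simp only [one_mul, add_zero] at h
  have h' := h.comp tendsto_natCast_atTop_atTop
  set δ : ℝ := (1 / (32 * c)) ^ 2 with hδ
  have hδ0 : 0 < δ := by rw [hδ]; positivity
  have hev : ∀ᶠ N : ℕ in atTop, Real.log (N : ℝ) ^ 4 / (N : ℝ) < δ :=
    h'.eventually (gt_mem_nhds hδ0)
  obtain ⟨N₁, hN₁⟩ := eventually_atTop.mp (hev.and (eventually_ge_atTop 1))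
  refine ⟨N₁, fun N hN => ?_⟩
  obtain ⟨hlt, hN1⟩ := hN₁ N hN
  have hNpos : (0 : ℝ) < N := by exact_mod_cast hN1
  have h4 : Real.log (N : ℝ) ^ 4 < δ * N := by rwa [div_lt_iff₀ hNpos] at hlt
  have hsq : (Real.log (N : ℝ) ^ 2) ^ 2 < (Real.sqrt δ * Real.sqrt N) ^ 2 := by
    have e1 : (Real.log (N : ℝ) ^ 2) ^ 2 = Real.log (N : ℝ) ^ 4 := by ring
    have e2 : (Real.sqrt δ * Real.sqrt N) ^ 2 = δ * N := by
      rw [mul_pow, Real.sq_sqrt hδ0.le, Real.sq_sqrt hNpos.le]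
    rw [e1, e2]; exact h4
  have h2 : Real.log (N : ℝ) ^ 2 < Real.sqrt δ * Real.sqrt N :=
    lt_of_pow_lt_pow_left₀ 2 (by positivity) hsq
  have hsδ : Real.sqrt δ = 1 / (32 * c) := by
    rw [hδ, Real.sqrt_sq (by positivity)]
  have hpre : 0 ≤ 6 * c * (N : ℝ) * Real.sqrt N := by positivity
  have hN2 : 0 < (N : ℝ) ^ 2 := by positivity
  calc 6 * c * N * Real.sqrt N * Real.log (N : ℝ) ^ 2
      ≤ 6 * c * N * Real.sqrt N * (Real.sqrt δ * Real.sqrt N) :=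
        mul_le_mul_of_nonneg_left h2.le hpre
    _ = 6 * c * Real.sqrt δ * N * (Real.sqrt N * Real.sqrt N) := by ring
    _ = 3 / 16 * (N : ℝ) ^ 2 := by
        rw [Real.mul_self_sqrt hNpos.le, hsδ]
        field_simp
        ring
    _ < 3 * (N : ℝ) ^ 2 / 8 := by linarith

/-- **Vinogradov's three-primes theorem** (I. M. Vinogradov 1937): every sufficiently large odd
`N` is a sum of three primes. From the asymptotic with `𝔖(Ψ_N) ≥ 1` (odd `N`) and the tree's
prime-power removal `exists_three_primes_of_lt_weightedTernaryCount'` (Chebyshev).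
[cite: Vinogradov1937] -/
theorem vinogradov_three_primes :
    ∃ N₀ : ℕ, ∀ N : ℕ, N₀ ≤ N → Odd N →
      ∃ p q r : ℕ, p.Prime ∧ q.Prime ∧ r.Prime ∧ p + q + r = N := by
  obtain ⟨N₀, hN₀⟩ := weightedTernaryCount_asymptotic_singularProduct (1 / 8) (by norm_num)
  obtain ⟨N₁, hN₁⟩ := eventually_chebyshevThreshold_lt
  refine ⟨max N₀ N₁, fun N hN hodd => exists_three_primes_of_lt_weightedTernaryCount' ?_⟩
  have h1 := hN₀ N (le_trans (le_max_left _ _) hN)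
  have h2 := hN₁ N (le_trans (le_max_right _ _) hN)
  have hS := one_le_singularProduct_ternarySystem hodd
  have hN2 : 0 ≤ (N : ℝ) ^ 2 := by positivity
  have h3 : 3 * (N : ℝ) ^ 2 / 8 ≤ weightedTernaryCount N := by
    have h1' := (abs_le.mp h1).1
    have hm : 1 * (N : ℝ) ^ 2 ≤ singularProduct (ternarySystem N) * (N : ℝ) ^ 2 :=
      mul_le_mul_of_nonneg_right hS hN2
    linarith
  exact lt_of_lt_of_le h2 h3

end Literature.NumberTheory.Sieve
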